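import Summits.Ventures.LatticeQCDFlow.Exactness.FlowSamplerSquareIntegrableAcceptanceCeiling
import Summits.Ventures.LatticeQCDFlow.Exactness.Phi4FlowSquareIntegrableCeiling
import HarnessLib

/-!
# Row 2's FLOW ARM: the acceptance-weighted ceiling `τ_int(f) ≤ E_{g²}[1/ρ]/ā − ½` for EVERY polynomial observable of lattice φ⁴ — the magnetisation included

HONEST FRAMING: exact (Metropolis-corrected) sampling algorithms for lattice gauge theory;
figures of merit are autocorrelation/cost numbers at stated couplings and volumes; no
continuum-physics claim.  (SCALAR calibration rung S0-A: not a gauge result.)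

Venture `LatticeQCDFlow` (cell pub-lqcd), topic `Exactness`; FANOUT row 2 (`s0-phi4`, FLOW arm
`K = imhOpPhi4 J λ q̃`, every `λ > 0`, real `J`, positive measurable model density with `∫ q̃ = 1`).
NEW WORK of the cell: the lattice instances of `FlowSamplerSquareIntegrableAcceptanceCeiling`
(`imhOp_tauInt_le_acceptanceCeiling_of_sq`, `imhOp_sum_range_autocov_le_acceptanceCeiling_of_sq`)
on the class `PolyObs` (`Phi4FlowSquareIntegrable`: `PolyObs ⊆ L²(e^{−S})`), plus two sufficient
conditions for the finiteness of the column `G₂ = ∫ g² e^{−S}/ρ` for UNBOUNDED `g`.  Nothing is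
cited as a fact (Deligiannidis–Lee 2018 NAMED in the general file).  The bounded-observable lattice
theorem `phi4Flow_tauInt_le_acceptanceCeiling` (`IMHTauIntLeAcceptanceCeiling`) stands.

## What is proved

General space (`w, q > 0` measurable integrable, `∫ q = 1`, `b = w/q`, `ρ = 1 − λ ∘ b`):
* `integrable_sq_mul_weight_div_acc_of_sq` — `W₂ = ∫ b w < ∞` and `∫ g² b w < ∞` ⇒ `g² w/ρ ∈ L¹`
  (`1/ρ ≤ (W₂ + bZ)/Z²`, `IMHAcceptanceGeHalfESS.one_sub_rejCurve_ge`);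
* `integral_sq_mul_weight_div_acc_le_of_sq`, **`imhOp_tauInt_le_acceptanceESS_of_sq`** — the same
  two moments give `G₂ ≤ (W₂/Z²) ∫ g² w + (1/Z) ∫ g² b w`, hence the i.i.d.-ESTIMABLE ceiling
  `τ_int(g) ≤ (W₂/Z² + (∫ g² b w)/(Z ∫ g² w))/ā − ½` for centred square-integrable `g`;
* `integrable_sq_mul_weight_div_acc_of_weightBound` — a weight bound `w ≤ C q` ⇒ `g² w/ρ ∈ L¹`
  for every square-integrable `g`.

Lattice (`Λ = Fin (n+1)`, `λ > 0`, `Z = ∫ e^{−S}`, `g = f − ⟨f⟩`, `ρ(φ) = 1 − λ(e^{−S(φ)}/q̃(φ))`,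
`P_ρ = ∫ ρ e^{−S} = ā Z`, `G₂ = ∫ g² e^{−S}/ρ`):
* **`phi4Flow_tauInt_le_acceptanceCeiling_poly`** — `f ∈ PolyObs`, `Var f > 0`, `G₂ < ∞`: the
  normalised autocorrelation series of `f` under the flow arm IS SUMMABLE and
  `τ_int(f) ≤ G₂ (Z/P_ρ) / ∫ g² e^{−S} − ½ = E_{g²}[1/ρ]/ā − ½`;
* **`phi4Flow_sum_range_autocov_le_acceptanceCeiling_poly`** — every partial sum
  `Σ_{k<N} C_g(k) ≤ G₂ Z/P_ρ` (finite windows);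
* **`phi4Flow_tauInt_le_acceptanceCeiling_magnetisation`** — the magnetisation `M = Σ_x φ_x`
  (`Var M > 0` from the tree): `G₂(M) < ∞ ⇒ τ_int(M) ≤ E_{M̃²}[1/ρ]/ā − ½`, the series summable;
* **`phi4Flow_tauInt_le_acceptanceCeiling_magnetisation_of_gaussian_minorant`** — the finiteness
  hypothesis DISCHARGED from a Gaussian minorant `q̃ ≥ c e^{−κΣφ²}` of the model density
  (affine-coupling flows with bounded log-scales; `gibbsWeight_le_of_gaussian_minorant`): the
  ceiling for `M` holds with both columns finite.

Reading for S0-A (no numerics implied): with `Phi4FlowSquareIntegrable` / `…Ceiling` the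
magnetisation under the flow arm now carries `½ + r̄_M/(1 − r̄_M) ≤ τ_int(M) ≤ min(C/Z, E_{M̃²}[1/ρ]/ā) − ½`
— the right-hand column `(ā, E_{M̃²}[1/ρ])` is measured at equilibrium, the left is the sup-norm
weight bound.  NOT CLAIMED: any value of `ā`, `G₂`, `W₂`, `C` for any run or trained network;
sharpness; anything for the HMC / local arms.
-/

namespace Summit.Ventures.LatticeQCDFlow.Exactness

open Real MeasureTheory Filter Finset Set
open Summit.Ventures.LatticeQCDFlow.Scoring

/-! ## §1 Finiteness of `G₂ = ∫ g² w/ρ` for unbounded observables (general space) -/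

section General

variable {X : Type*} [MeasurableSpace X] {μ : Measure X} [SFinite μ] {w q : X → ℝ}

/-- **`g² w/ρ ∈ L¹`** for measurable `g` under a finite second weight moment `W₂ = ∫ b w < ∞` and
`∫ g² b w < ∞` (`1/ρ ≤ (W₂ + bZ)/Z²`, `IMHAcceptanceGeHalfESS.one_sub_rejCurve_ge`); for bounded `g`
the second hypothesis follows from the first (`IMHDirichletForm.integrable_sq_mul_weight_div_acc`). -/
theorem integrable_sq_mul_weight_div_acc_of_sq (hw0 : ∀ t, 0 < w t) (hwm : Measurable w)
    (hwi : Integrable w μ) (hq0 : ∀ t, 0 < q t) (hqm : Measurable q) (hqi : Integrable q μ)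
    (hq1 : ∫ z, q z ∂μ = 1) (hW₂ : Integrable (fun x => w x / q x * w x) μ) {g : X → ℝ}
    (hgm : Measurable g) (hg2 : Integrable (fun t => g t ^ 2 * w t) μ)
    (hgb : Integrable (fun t => g t ^ 2 * (w t / q t) * w t) μ) :
    Integrable (fun t => g t ^ 2 * w t / (1 - rejCurve μ w q (w t / q t))) μ := by
  set Z : ℝ := ∫ z, w z ∂μ with hZdef
  set W : ℝ := ∫ z, w z / q z * w z ∂μ with hWdef
  have hZ : 0 < Z := integral_pos_of_pos hw0 hwi hq1
  have hb0 : ∀ t, 0 < w t / q t := fun t => div_pos (hw0 t) (hq0 t)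
  have hW0 : 0 ≤ W := integral_nonneg fun z => mul_nonneg (hb0 z).le (hw0 z).le
  have hρpos : ∀ t, 0 < 1 - rejCurve μ w q (w t / q t) := fun t =>
    (acc_mul_weight_le hw0 hwm hwi hq0 hqm hqi hq1 t).2.1
  have hdom : Integrable (fun t => 1 / Z ^ 2 * (W * (g t ^ 2 * w t) + Z * (g t ^ 2 * (w t / q t) * w t)))
      μ := ((hg2.const_mul W).add (hgb.const_mul Z)).const_mul _
  refine Integrable.mono' hdom (((hgm.pow_const 2).mul hwm).div (measurable_const.sub
    ((measurable_rejCurve hwm hqm).comp (hwm.div hqm)))).aestronglyMeasurable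
    (Eventually.of_forall fun t => ?_)
  have hρ := one_sub_rejCurve_ge hw0 hwm hwi hq0 hqm hqi hq1 hW₂ (hb0 t)
  rw [← hZdef, ← hWdef] at hρ
  have hden : 0 < W + w t / q t * Z := add_pos_of_nonneg_of_pos hW0 (mul_pos (hb0 t) hZ)
  rw [Real.norm_eq_abs, abs_of_nonneg (div_nonneg (mul_nonneg (sq_nonneg _) (hw0 t).le) (hρpos t).le)]
  calc g t ^ 2 * w t / (1 - rejCurve μ w q (w t / q t))
      ≤ g t ^ 2 * w t / (Z ^ 2 / (W + w t / q t * Z)) :=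
        div_le_div_of_nonneg_left (mul_nonneg (sq_nonneg _) (hw0 t).le)
          (div_pos (pow_pos hZ 2) hden) hρ
    _ = 1 / Z ^ 2 * (W * (g t ^ 2 * w t) + Z * (g t ^ 2 * (w t / q t) * w t)) := by
        field_simp

/-- **The column `G₂` against i.i.d.-estimable moments**: `W₂ = ∫ b w < ∞`, `∫ g² b w < ∞` ⇒
`∫ g² w/ρ ≤ (W₂/Z²) ∫ g² w + (1/Z) ∫ g² b w` (`1/ρ ≤ (W₂ + bZ)/Z²` integrated against `g² w`). -/
theorem integral_sq_mul_weight_div_acc_le_of_sq (hw0 : ∀ t, 0 < w t) (hwm : Measurable w)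
    (hwi : Integrable w μ) (hq0 : ∀ t, 0 < q t) (hqm : Measurable q) (hqi : Integrable q μ)
    (hq1 : ∫ z, q z ∂μ = 1) (hW₂ : Integrable (fun x => w x / q x * w x) μ) {g : X → ℝ}
    (hgm : Measurable g) (hg2 : Integrable (fun t => g t ^ 2 * w t) μ)
    (hgb : Integrable (fun t => g t ^ 2 * (w t / q t) * w t) μ) :
    ∫ t, g t ^ 2 * w t / (1 - rejCurve μ w q (w t / q t)) ∂μ
      ≤ (∫ z, w z / q z * w z ∂μ) / (∫ z, w z ∂μ) ^ 2 * ∫ t, g t ^ 2 * w t ∂μ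
        + 1 / (∫ z, w z ∂μ) * ∫ t, g t ^ 2 * (w t / q t) * w t ∂μ := by
  set Z : ℝ := ∫ z, w z ∂μ with hZdef
  set W : ℝ := ∫ z, w z / q z * w z ∂μ with hWdef
  have hZ : 0 < Z := integral_pos_of_pos hw0 hwi hq1
  have hb0 : ∀ t, 0 < w t / q t := fun t => div_pos (hw0 t) (hq0 t)
  have hW0 : 0 ≤ W := integral_nonneg fun z => mul_nonneg (hb0 z).le (hw0 z).le
  rw [← integral_const_mul, ← integral_const_mul, ← integral_add (hg2.const_mul _) (hgb.const_mul _)]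
  refine integral_mono (integrable_sq_mul_weight_div_acc_of_sq hw0 hwm hwi hq0 hqm hqi hq1 hW₂ hgm hg2
    hgb) ((hg2.const_mul _).add (hgb.const_mul _)) fun t => ?_
  have hρ := one_sub_rejCurve_ge hw0 hwm hwi hq0 hqm hqi hq1 hW₂ (hb0 t)
  rw [← hZdef, ← hWdef] at hρ
  have hden : 0 < W + w t / q t * Z := add_pos_of_nonneg_of_pos hW0 (mul_pos (hb0 t) hZ)
  calc g t ^ 2 * w t / (1 - rejCurve μ w q (w t / q t))
      ≤ g t ^ 2 * w t / (Z ^ 2 / (W + w t / q t * Z)) :=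
        div_le_div_of_nonneg_left (mul_nonneg (sq_nonneg _) (hw0 t).le)
          (div_pos (pow_pos hZ 2) hden) hρ
    _ = W / Z ^ 2 * (g t ^ 2 * w t) + 1 / Z * (g t ^ 2 * (w t / q t) * w t) := by
        field_simp

/-- **THE CEILING IN i.i.d.-ESTIMABLE FORM on `L²(w)`**: with `W₂ = ∫ b w < ∞` (`Z²/W₂` is the flow's
importance-sampling effective sample size per draw), `∫ g² b w < ∞`, `P = ∫ g² w > 0` and `g` centred:
`τ_int(g) ≤ (W₂/Z² + (∫ g² b w)/(Z P)) / ā − ½` — every column an equilibrium or model average. -/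
theorem imhOp_tauInt_le_acceptanceESS_of_sq (hw0 : ∀ t, 0 < w t) (hwm : Measurable w)
    (hwi : Integrable w μ) (hq0 : ∀ t, 0 < q t) (hqm : Measurable q) (hqi : Integrable q μ)
    (hq1 : ∫ z, q z ∂μ = 1) (hW₂ : Integrable (fun x => w x / q x * w x) μ) {g : X → ℝ}
    (hgm : Measurable g) (hg2 : Integrable (fun t => g t ^ 2 * w t) μ) (hg0 : ∫ t, g t * w t ∂μ = 0)
    (hP : 0 < ∫ t, g t ^ 2 * w t ∂μ) (hgb : Integrable (fun t => g t ^ 2 * (w t / q t) * w t) μ) :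
    tauInt (fun n => (∫ t, g t * ((imhOp μ w q)^[n] g) t * w t ∂μ) / ∫ t, g t ^ 2 * w t ∂μ)
      ≤ ((∫ z, w z / q z * w z ∂μ) / (∫ z, w z ∂μ) ^ 2
          + (∫ t, g t ^ 2 * (w t / q t) * w t ∂μ) / ((∫ z, w z ∂μ) * ∫ t, g t ^ 2 * w t ∂μ))
          / ((∫ t, (1 - rejCurve μ w q (w t / q t)) * w t ∂μ) / ∫ z, w z ∂μ) - 1 / 2 := by
  have hG := integrable_sq_mul_weight_div_acc_of_sq hw0 hwm hwi hq0 hqm hqi hq1 hW₂ hgm hg2 hgb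
  have h := (imhOp_tauInt_le_acceptanceCeiling_of_sq hw0 hwm hwi hq0 hqm hqi hq1 hgm hg2 hg0 hP hG).2
  refine h.trans ?_
  have hle := integral_sq_mul_weight_div_acc_le_of_sq hw0 hwm hwi hq0 hqm hqi hq1 hW₂ hgm hg2 hgb
  set A : ℝ := ∫ t, g t ^ 2 * w t ∂μ with hAdef
  set Z : ℝ := ∫ z, w z ∂μ with hZdef
  set W : ℝ := ∫ z, w z / q z * w z ∂μ with hWdef
  set Pρ : ℝ := ∫ t, (1 - rejCurve μ w q (w t / q t)) * w t ∂μ with hPρdef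
  set Gb : ℝ := ∫ t, g t ^ 2 * (w t / q t) * w t ∂μ with hGb
  set G₂ : ℝ := ∫ t, g t ^ 2 * w t / (1 - rejCurve μ w q (w t / q t)) ∂μ with hG₂
  have hZ : 0 < Z := integral_pos_of_pos hw0 hwi hq1
  have hPρ : 0 < Pρ := (acc_mul_weight_integral_pos hw0 hwm hwi hq0 hqm hqi hq1).2
  have e1 : G₂ * (Z / Pρ) / A - 1 / 2 = G₂ / (Pρ / Z * A) - 1 / 2 := by
    field_simp
  have e2 : (W / Z ^ 2 + Gb / (Z * A)) / (Pρ / Z) - 1 / 2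
      = (W / Z ^ 2 * A + 1 / Z * Gb) / (Pρ / Z * A) - 1 / 2 := by
    field_simp
  rw [e1, e2]
  have hden : 0 < Pρ / Z * A := mul_pos (div_pos hPρ hZ) hP
  linarith [div_le_div_of_nonneg_right hle hden.le]

/-- **A weight bound makes `G₂` finite for every square-integrable observable**: `w ≤ C q` ⇒
`W₂ ≤ C Z`, `∫ g² b w ≤ C ∫ g² w`, hence `g² w/ρ ∈ L¹` (the uniform-ergodicity regime of
`FlowSamplerSquareIntegrableCeiling`; there also `1/ρ ≤ C/Z`). -/
theorem integrable_sq_mul_weight_div_acc_of_weightBound (hw0 : ∀ t, 0 < w t) (hwm : Measurable w)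
    (hwi : Integrable w μ) (hq0 : ∀ t, 0 < q t) (hqm : Measurable q) (hqi : Integrable q μ)
    (hq1 : ∫ z, q z ∂μ = 1) {C : ℝ} (hC : ∀ t, w t ≤ C * q t) {g : X → ℝ} (hgm : Measurable g)
    (hg2 : Integrable (fun t => g t ^ 2 * w t) μ) :
    Integrable (fun t => g t ^ 2 * w t / (1 - rejCurve μ w q (w t / q t))) μ := by
  have hb : ∀ t, 0 ≤ w t / q t ∧ w t / q t ≤ C := fun t =>
    ⟨(div_pos (hw0 t) (hq0 t)).le, (div_le_iff₀ (hq0 t)).2 (hC t)⟩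
  have hbm : Measurable fun t => w t / q t := hwm.div hqm
  have hW₂ : Integrable (fun x => w x / q x * w x) μ := by
    refine Integrable.mono' (hwi.const_mul C) (hbm.mul hwm).aestronglyMeasurable
      (Eventually.of_forall fun t => ?_)
    rw [Real.norm_eq_abs, abs_of_nonneg (mul_nonneg (hb t).1 (hw0 t).le)]
    exact mul_le_mul_of_nonneg_right (hb t).2 (hw0 t).le
  have hgb : Integrable (fun t => g t ^ 2 * (w t / q t) * w t) μ := by
    refine Integrable.mono' (hg2.const_mul C) (((hgm.pow_const 2).mul hbm).mul hwm).aestronglyMeasurable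
      (Eventually.of_forall fun t => ?_)
    rw [Real.norm_eq_abs, abs_of_nonneg (mul_nonneg (mul_nonneg (sq_nonneg _) (hb t).1) (hw0 t).le)]
    calc g t ^ 2 * (w t / q t) * w t ≤ g t ^ 2 * C * w t :=
          mul_le_mul_of_nonneg_right (mul_le_mul_of_nonneg_left (hb t).2 (sq_nonneg _)) (hw0 t).le
      _ = C * (g t ^ 2 * w t) := by ring
  exact integrable_sq_mul_weight_div_acc_of_sq hw0 hwm hwi hq0 hqm hqi hq1 hW₂ hgm hg2 hgb

end General

/-! ## §2 The lattice: row 2's φ⁴ flow sampler on `PolyObs` -/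

section Lattice

variable {n : ℕ}

/-- **THE ACCEPTANCE-WEIGHTED CEILING FOR EVERY POLYNOMIAL OBSERVABLE OF LATTICE φ⁴.**  Every
`λ > 0`, real `J`, positive measurable model density `q̃` with `∫ q̃ = 1`; `f ∈ PolyObs` with
`Var f > 0` and `g = f − ⟨f⟩`; `ρ(φ) = 1 − λ(e^{−S(φ)}/q̃(φ))`, `Z = ∫ e^{−S}`; finiteness of the column
`G₂ = ∫ g² e^{−S}/ρ`.  Then the normalised autocorrelation series of `f` under `imhOpPhi4 J λ q̃` is
summable and `τ_int(f) ≤ G₂ · (Z/∫ ρ e^{−S}) / ∫ g² e^{−S} − ½ = E_{g²}[1/ρ]/ā − ½`. -/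
theorem phi4Flow_tauInt_le_acceptanceCeiling_poly {lam : ℝ} (hlam : 0 < lam)
    (J : Fin (n + 1) → Fin (n + 1) → ℝ) {q : (Fin (n + 1) → ℝ) → ℝ} (hq0 : ∀ φ, 0 < q φ)
    (hqm : Measurable q) (hqi : Integrable q) (hq1 : ∫ φ, q φ = 1) {f : (Fin (n + 1) → ℝ) → ℝ}
    (hf : PolyObs f) (hP : 0 < ∫ φ, (f φ - gibbsExpect J lam f) ^ 2 * gibbsWeight J lam φ)
    (hG : Integrable (fun φ => (f φ - gibbsExpect J lam f) ^ 2 * gibbsWeight J lam φ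
      / (1 - rejCurve volume (gibbsWeight J lam) q (gibbsWeight J lam φ / q φ)))) :
    (Summable fun k => (∫ φ, (f φ - gibbsExpect J lam f)
        * ((imhOpPhi4 J lam q)^[k + 1] (fun ψ => f ψ - gibbsExpect J lam f)) φ * gibbsWeight J lam φ)
        / ∫ φ, (f φ - gibbsExpect J lam f) ^ 2 * gibbsWeight J lam φ) ∧
    tauInt (fun k => (∫ φ, (f φ - gibbsExpect J lam f)
        * ((imhOpPhi4 J lam q)^[k] (fun ψ => f ψ - gibbsExpect J lam f)) φ * gibbsWeight J lam φ)
        / ∫ φ, (f φ - gibbsExpect J lam f) ^ 2 * gibbsWeight J lam φ)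
      ≤ (∫ φ, (f φ - gibbsExpect J lam f) ^ 2 * gibbsWeight J lam φ
            / (1 - rejCurve volume (gibbsWeight J lam) q (gibbsWeight J lam φ / q φ)))
          * ((∫ φ, gibbsWeight J lam φ) / ∫ φ, (1 - rejCurve volume (gibbsWeight J lam) q
              (gibbsWeight J lam φ / q φ)) * gibbsWeight J lam φ)
          / (∫ φ, (f φ - gibbsExpect J lam f) ^ 2 * gibbsWeight J lam φ) - 1 / 2 := by
  obtain ⟨hgm, hg2⟩ := polyObs_sq_integrable hlam J (polyObs_sub_const hf (gibbsExpect J lam f))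
  have hg0 := integral_polyObs_sub_gibbsExpect hlam J hf
  rw [imhOpPhi4_eq_imhOp]
  exact imhOp_tauInt_le_acceptanceCeiling_of_sq (μ := volume) (fun φ => gibbsWeight_pos J lam φ)
    (continuous_gibbsWeight J lam).measurable (integrable_gibbsWeight hlam J) hq0 hqm hqi hq1 hgm hg2
    hg0 hP hG

/-- **EVERY FINITE WINDOW IS CAPPED**: for `f ∈ PolyObs`, `g = f − ⟨f⟩` with `G₂ < ∞` and every `N`:
`Σ_{k<N} ∫ g (Kᵏ g) e^{−S} ≤ G₂ · Z/∫ ρ e^{−S}` (all terms `≥ 0`). -/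
theorem phi4Flow_sum_range_autocov_le_acceptanceCeiling_poly {lam : ℝ} (hlam : 0 < lam)
    (J : Fin (n + 1) → Fin (n + 1) → ℝ) {q : (Fin (n + 1) → ℝ) → ℝ} (hq0 : ∀ φ, 0 < q φ)
    (hqm : Measurable q) (hqi : Integrable q) (hq1 : ∫ φ, q φ = 1) {f : (Fin (n + 1) → ℝ) → ℝ}
    (hf : PolyObs f)
    (hG : Integrable (fun φ => (f φ - gibbsExpect J lam f) ^ 2 * gibbsWeight J lam φ
      / (1 - rejCurve volume (gibbsWeight J lam) q (gibbsWeight J lam φ / q φ)))) (N : ℕ) :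
    ∑ k ∈ Finset.range N, ∫ φ, (f φ - gibbsExpect J lam f)
        * ((imhOpPhi4 J lam q)^[k] (fun ψ => f ψ - gibbsExpect J lam f)) φ * gibbsWeight J lam φ
      ≤ (∫ φ, (f φ - gibbsExpect J lam f) ^ 2 * gibbsWeight J lam φ
            / (1 - rejCurve volume (gibbsWeight J lam) q (gibbsWeight J lam φ / q φ)))
          * ((∫ φ, gibbsWeight J lam φ) / ∫ φ, (1 - rejCurve volume (gibbsWeight J lam) q
              (gibbsWeight J lam φ / q φ)) * gibbsWeight J lam φ) := by
  obtain ⟨hgm, hg2⟩ := polyObs_sq_integrable hlam J (polyObs_sub_const hf (gibbsExpect J lam f))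
  have hg0 := integral_polyObs_sub_gibbsExpect hlam J hf
  rw [imhOpPhi4_eq_imhOp]
  exact imhOp_sum_range_autocov_le_acceptanceCeiling_of_sq (μ := volume)
    (fun φ => gibbsWeight_pos J lam φ) (continuous_gibbsWeight J lam).measurable
    (integrable_gibbsWeight hlam J) hq0 hqm hqi hq1 hgm hg2 hg0 hG N

/-- **THE MAGNETISATION'S ACCEPTANCE-WEIGHTED CEILING UNDER THE FLOW ARM**: with `M = Σ_x φ_x`,
`M̃ = M − ⟨M⟩` (`Var M > 0` is the tree's `integral_magnetisation_sub_sq_mul_gibbsWeight_pos`) and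
`G₂(M) = ∫ M̃² e^{−S}/ρ < ∞`: the autocorrelation series of `M` is summable and
`τ_int(M) ≤ G₂(M) (Z/∫ ρ e^{−S}) / ∫ M̃² e^{−S} − ½ = E_{M̃²}[1/ρ]/ā − ½`. -/
theorem phi4Flow_tauInt_le_acceptanceCeiling_magnetisation {lam : ℝ} (hlam : 0 < lam)
    (J : Fin (n + 1) → Fin (n + 1) → ℝ) {q : (Fin (n + 1) → ℝ) → ℝ} (hq0 : ∀ φ, 0 < q φ)
    (hqm : Measurable q) (hqi : Integrable q) (hq1 : ∫ φ, q φ = 1)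
    (hG : Integrable (fun φ => ((∑ x, φ x) - gibbsExpect J lam (fun ψ => ∑ x, ψ x)) ^ 2
      * gibbsWeight J lam φ
      / (1 - rejCurve volume (gibbsWeight J lam) q (gibbsWeight J lam φ / q φ)))) :
    (Summable fun k => (∫ φ, ((∑ x, φ x) - gibbsExpect J lam (fun ψ => ∑ x, ψ x))
        * ((imhOpPhi4 J lam q)^[k + 1]
            (fun ψ => (∑ x, ψ x) - gibbsExpect J lam (fun ψ => ∑ x, ψ x))) φ * gibbsWeight J lam φ)
        / ∫ φ, ((∑ x, φ x) - gibbsExpect J lam (fun ψ => ∑ x, ψ x)) ^ 2 * gibbsWeight J lam φ) ∧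
    tauInt (fun k => (∫ φ, ((∑ x, φ x) - gibbsExpect J lam (fun ψ => ∑ x, ψ x))
        * ((imhOpPhi4 J lam q)^[k]
            (fun ψ => (∑ x, ψ x) - gibbsExpect J lam (fun ψ => ∑ x, ψ x))) φ * gibbsWeight J lam φ)
        / ∫ φ, ((∑ x, φ x) - gibbsExpect J lam (fun ψ => ∑ x, ψ x)) ^ 2 * gibbsWeight J lam φ)
      ≤ (∫ φ, ((∑ x, φ x) - gibbsExpect J lam (fun ψ => ∑ x, ψ x)) ^ 2 * gibbsWeight J lam φ
            / (1 - rejCurve volume (gibbsWeight J lam) q (gibbsWeight J lam φ / q φ)))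
          * ((∫ φ, gibbsWeight J lam φ) / ∫ φ, (1 - rejCurve volume (gibbsWeight J lam) q
              (gibbsWeight J lam φ / q φ)) * gibbsWeight J lam φ)
          / (∫ φ, ((∑ x, φ x) - gibbsExpect J lam (fun ψ => ∑ x, ψ x)) ^ 2 * gibbsWeight J lam φ)
        - 1 / 2 :=
  phi4Flow_tauInt_le_acceptanceCeiling_poly hlam J hq0 hqm hqi hq1 polyObs_magnetisation
    (integral_magnetisation_sub_sq_mul_gibbsWeight_pos hlam J _) hG

/-- **THE FINITENESS HYPOTHESIS DISCHARGED FROM A GAUSSIAN MINORANT OF THE FLOW'S DENSITY**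
(affine-coupling flows with bounded log-scales, as in `Phi4FlowSamplerGaussianMinorant`):
`q̃ ≥ c e^{−κΣ_w φ_w²}` with `c > 0` ⇒ `e^{−S} ≤ C q̃` (`gibbsWeight_le_of_gaussian_minorant`) ⇒
`G₂(M) < ∞`, so the magnetisation's series under the flow arm is summable and
`τ_int(M) ≤ E_{M̃²}[1/ρ]/ā − ½` with both columns finite. -/
theorem phi4Flow_tauInt_le_acceptanceCeiling_magnetisation_of_gaussian_minorant {lam : ℝ}
    (hlam : 0 < lam) (J : Fin (n + 1) → Fin (n + 1) → ℝ) {q : (Fin (n + 1) → ℝ) → ℝ}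
    (hq0 : ∀ φ, 0 < q φ) (hqm : Measurable q) (hqi : Integrable q) (hq1 : ∫ φ, q φ = 1)
    {c κ : ℝ} (hc : 0 < c) (hqc : ∀ φ, c * Real.exp (-(κ * ∑ w, φ w ^ 2)) ≤ q φ) :
    Integrable (fun φ => ((∑ x, φ x) - gibbsExpect J lam (fun ψ => ∑ x, ψ x)) ^ 2
      * gibbsWeight J lam φ
      / (1 - rejCurve volume (gibbsWeight J lam) q (gibbsWeight J lam φ / q φ))) ∧
    (Summable fun k => (∫ φ, ((∑ x, φ x) - gibbsExpect J lam (fun ψ => ∑ x, ψ x))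
        * ((imhOpPhi4 J lam q)^[k + 1]
            (fun ψ => (∑ x, ψ x) - gibbsExpect J lam (fun ψ => ∑ x, ψ x))) φ * gibbsWeight J lam φ)
        / ∫ φ, ((∑ x, φ x) - gibbsExpect J lam (fun ψ => ∑ x, ψ x)) ^ 2 * gibbsWeight J lam φ) ∧
    tauInt (fun k => (∫ φ, ((∑ x, φ x) - gibbsExpect J lam (fun ψ => ∑ x, ψ x))
        * ((imhOpPhi4 J lam q)^[k]
            (fun ψ => (∑ x, ψ x) - gibbsExpect J lam (fun ψ => ∑ x, ψ x))) φ * gibbsWeight J lam φ)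
        / ∫ φ, ((∑ x, φ x) - gibbsExpect J lam (fun ψ => ∑ x, ψ x)) ^ 2 * gibbsWeight J lam φ)
      ≤ (∫ φ, ((∑ x, φ x) - gibbsExpect J lam (fun ψ => ∑ x, ψ x)) ^ 2 * gibbsWeight J lam φ
            / (1 - rejCurve volume (gibbsWeight J lam) q (gibbsWeight J lam φ / q φ)))
          * ((∫ φ, gibbsWeight J lam φ) / ∫ φ, (1 - rejCurve volume (gibbsWeight J lam) q
              (gibbsWeight J lam φ / q φ)) * gibbsWeight J lam φ)
          / (∫ φ, ((∑ x, φ x) - gibbsExpect J lam (fun ψ => ∑ x, ψ x)) ^ 2 * gibbsWeight J lam φ)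
        - 1 / 2 := by
  obtain ⟨hgm, hg2⟩ := polyObs_sq_integrable hlam J
    (polyObs_sub_const polyObs_magnetisation (gibbsExpect J lam (fun ψ => ∑ x, ψ x)))
  have hG := integrable_sq_mul_weight_div_acc_of_weightBound (μ := volume)
    (fun φ => gibbsWeight_pos J lam φ) (continuous_gibbsWeight J lam).measurable
    (integrable_gibbsWeight hlam J) hq0 hqm hqi hq1 (gibbsWeight_le_of_gaussian_minorant hlam J hc hqc)
    hgm hg2
  exact ⟨hG, phi4Flow_tauInt_le_acceptanceCeiling_magnetisation hlam J hq0 hqm hqi hq1 hG⟩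

end Lattice

end Summit.Ventures.LatticeQCDFlow.Exactness

/-! ## §3 The ceiling in i.i.d.-ESTIMABLE form on the lattice (GEN-22 append): `§1`'s
`imhOp_tauInt_le_acceptanceESS_of_sq` on `PolyObs` — the columns are the flow's weight moment
`W₂ = ∫ b e^{−S}` (`Z²/W₂` = importance-sampling ESS per model draw) and `∫ g² b e^{−S}`, `b = e^{−S}/q̃`,
both finite under a Gaussian minorant of the model.  NOT CLAIMED: any value of `W₂`, `ā`. -/

namespace Summit.Ventures.LatticeQCDFlow.Exactness

open Real MeasureTheory Filter Finset Set
open Summit.Ventures.LatticeQCDFlow.Scoring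

/-- A weight bound `w ≤ C q` makes both i.i.d.-estimable columns finite: `W₂ = ∫ b w < ∞` and
`∫ g² b w < ∞` for every square-integrable `g` (`0 ≤ b = w/q ≤ C`). -/
theorem weightMoments_integrable_of_weightBound {X : Type*} [MeasurableSpace X] {μ : Measure X}
    {w q : X → ℝ} (hw0 : ∀ t, 0 < w t) (hwm : Measurable w) (hwi : Integrable w μ)
    (hq0 : ∀ t, 0 < q t) (hqm : Measurable q) {C : ℝ} (hC : ∀ t, w t ≤ C * q t) {g : X → ℝ}
    (hgm : Measurable g) (hg2 : Integrable (fun t => g t ^ 2 * w t) μ) :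
    Integrable (fun x => w x / q x * w x) μ ∧ Integrable (fun t => g t ^ 2 * (w t / q t) * w t) μ := by
  have hb : ∀ t, 0 ≤ w t / q t ∧ w t / q t ≤ C := fun t =>
    ⟨(div_pos (hw0 t) (hq0 t)).le, (div_le_iff₀ (hq0 t)).2 (hC t)⟩
  have hbm : Measurable fun t => w t / q t := hwm.div hqm
  refine ⟨?_, ?_⟩
  · refine Integrable.mono' (hwi.const_mul C) (hbm.mul hwm).aestronglyMeasurable
      (Eventually.of_forall fun t => ?_)
    rw [Real.norm_eq_abs, abs_of_nonneg (mul_nonneg (hb t).1 (hw0 t).le)]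
    exact mul_le_mul_of_nonneg_right (hb t).2 (hw0 t).le
  · refine Integrable.mono' (hg2.const_mul C) (((hgm.pow_const 2).mul hbm).mul hwm).aestronglyMeasurable
      (Eventually.of_forall fun t => ?_)
    rw [Real.norm_eq_abs, abs_of_nonneg (mul_nonneg (mul_nonneg (sq_nonneg _) (hb t).1) (hw0 t).le)]
    calc g t ^ 2 * (w t / q t) * w t ≤ g t ^ 2 * C * w t :=
          mul_le_mul_of_nonneg_right (mul_le_mul_of_nonneg_left (hb t).2 (sq_nonneg _)) (hw0 t).le
      _ = C * (g t ^ 2 * w t) := by ring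

section LatticeESS

variable {n : ℕ}

/-- **THE i.i.d.-ESTIMABLE CEILING FOR EVERY POLYNOMIAL OBSERVABLE OF LATTICE φ⁴** (every `λ > 0`,
real `J`, positive measurable model density, `∫ q̃ = 1`; `f ∈ PolyObs`, `Var f > 0`, `g = f − ⟨f⟩`,
`b = e^{−S}/q̃`): `W₂ = ∫ b e^{−S} < ∞` and `∫ g² b e^{−S} < ∞` ⇒
`τ_int(f) ≤ (W₂/Z² + (∫ g² b e^{−S})/(Z ∫ g² e^{−S})) / ā − ½`. -/
theorem phi4Flow_tauInt_le_acceptanceESS_poly {lam : ℝ} (hlam : 0 < lam)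
    (J : Fin (n + 1) → Fin (n + 1) → ℝ) {q : (Fin (n + 1) → ℝ) → ℝ} (hq0 : ∀ φ, 0 < q φ)
    (hqm : Measurable q) (hqi : Integrable q) (hq1 : ∫ φ, q φ = 1) {f : (Fin (n + 1) → ℝ) → ℝ}
    (hf : PolyObs f) (hP : 0 < ∫ φ, (f φ - gibbsExpect J lam f) ^ 2 * gibbsWeight J lam φ)
    (hW₂ : Integrable (fun φ => gibbsWeight J lam φ / q φ * gibbsWeight J lam φ))
    (hgb : Integrable (fun φ => (f φ - gibbsExpect J lam f) ^ 2 * (gibbsWeight J lam φ / q φ)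
      * gibbsWeight J lam φ)) :
    tauInt (fun k => (∫ φ, (f φ - gibbsExpect J lam f)
        * ((imhOpPhi4 J lam q)^[k] (fun ψ => f ψ - gibbsExpect J lam f)) φ * gibbsWeight J lam φ)
        / ∫ φ, (f φ - gibbsExpect J lam f) ^ 2 * gibbsWeight J lam φ)
      ≤ ((∫ φ, gibbsWeight J lam φ / q φ * gibbsWeight J lam φ) / (∫ φ, gibbsWeight J lam φ) ^ 2
          + (∫ φ, (f φ - gibbsExpect J lam f) ^ 2 * (gibbsWeight J lam φ / q φ) * gibbsWeight J lam φ)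
            / ((∫ φ, gibbsWeight J lam φ) * ∫ φ, (f φ - gibbsExpect J lam f) ^ 2 * gibbsWeight J lam φ))
          / ((∫ φ, (1 - rejCurve volume (gibbsWeight J lam) q (gibbsWeight J lam φ / q φ))
              * gibbsWeight J lam φ) / ∫ φ, gibbsWeight J lam φ) - 1 / 2 := by
  obtain ⟨hgm, hg2⟩ := polyObs_sq_integrable hlam J (polyObs_sub_const hf (gibbsExpect J lam f))
  have hg0 := integral_polyObs_sub_gibbsExpect hlam J hf
  rw [imhOpPhi4_eq_imhOp]
  exact imhOp_tauInt_le_acceptanceESS_of_sq (μ := volume) (fun φ => gibbsWeight_pos J lam φ)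
    (continuous_gibbsWeight J lam).measurable (integrable_gibbsWeight hlam J) hq0 hqm hqi hq1 hW₂ hgm
    hg2 hg0 hP hgb

/-- **THE MAGNETISATION'S i.i.d.-ESTIMABLE CEILING, BOTH COLUMNS FINITE UNDER A GAUSSIAN MINORANT**
(`q̃ ≥ c e^{−κΣφ²}`, `c > 0` ⇒ `e^{−S} ≤ C q̃`, `gibbsWeight_le_of_gaussian_minorant`): `W₂ < ∞`,
`∫ M̃² b e^{−S} < ∞`, and `τ_int(M) ≤ (W₂/Z² + (∫ M̃² b e^{−S})/(Z Var M)) / ā − ½` under the flow arm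
(`Var M = ∫ M̃² e^{−S} > 0` from the tree). -/
theorem phi4Flow_tauInt_le_acceptanceESS_magnetisation_of_gaussian_minorant {lam : ℝ}
    (hlam : 0 < lam) (J : Fin (n + 1) → Fin (n + 1) → ℝ) {q : (Fin (n + 1) → ℝ) → ℝ}
    (hq0 : ∀ φ, 0 < q φ) (hqm : Measurable q) (hqi : Integrable q) (hq1 : ∫ φ, q φ = 1)
    {c κ : ℝ} (hc : 0 < c) (hqc : ∀ φ, c * Real.exp (-(κ * ∑ w, φ w ^ 2)) ≤ q φ) :
    Integrable (fun φ => gibbsWeight J lam φ / q φ * gibbsWeight J lam φ) ∧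
    Integrable (fun φ => ((∑ x, φ x) - gibbsExpect J lam (fun ψ => ∑ x, ψ x)) ^ 2
      * (gibbsWeight J lam φ / q φ) * gibbsWeight J lam φ) ∧
    tauInt (fun k => (∫ φ, ((∑ x, φ x) - gibbsExpect J lam (fun ψ => ∑ x, ψ x))
        * ((imhOpPhi4 J lam q)^[k]
            (fun ψ => (∑ x, ψ x) - gibbsExpect J lam (fun ψ => ∑ x, ψ x))) φ * gibbsWeight J lam φ)
        / ∫ φ, ((∑ x, φ x) - gibbsExpect J lam (fun ψ => ∑ x, ψ x)) ^ 2 * gibbsWeight J lam φ)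
      ≤ ((∫ φ, gibbsWeight J lam φ / q φ * gibbsWeight J lam φ) / (∫ φ, gibbsWeight J lam φ) ^ 2
          + (∫ φ, ((∑ x, φ x) - gibbsExpect J lam (fun ψ => ∑ x, ψ x)) ^ 2
              * (gibbsWeight J lam φ / q φ) * gibbsWeight J lam φ)
            / ((∫ φ, gibbsWeight J lam φ)
              * ∫ φ, ((∑ x, φ x) - gibbsExpect J lam (fun ψ => ∑ x, ψ x)) ^ 2 * gibbsWeight J lam φ))
          / ((∫ φ, (1 - rejCurve volume (gibbsWeight J lam) q (gibbsWeight J lam φ / q φ))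
              * gibbsWeight J lam φ) / ∫ φ, gibbsWeight J lam φ) - 1 / 2 := by
  obtain ⟨hgm, hg2⟩ := polyObs_sq_integrable hlam J
    (polyObs_sub_const polyObs_magnetisation (gibbsExpect J lam (fun ψ => ∑ x, ψ x)))
  obtain ⟨hW₂, hgb⟩ := weightMoments_integrable_of_weightBound (μ := volume)
    (fun φ => gibbsWeight_pos J lam φ) (continuous_gibbsWeight J lam).measurable
    (integrable_gibbsWeight hlam J) hq0 hqm (gibbsWeight_le_of_gaussian_minorant hlam J hc hqc) hgm hg2
  exact ⟨hW₂, hgb, phi4Flow_tauInt_le_acceptanceESS_poly hlam J hq0 hqm hqi hq1 polyObs_magnetisation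
    (integral_magnetisation_sub_sq_mul_gibbsWeight_pos hlam J _) hW₂ hgb⟩

end LatticeESS

end Summit.Ventures.LatticeQCDFlow.Exactness
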